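import Summits.QuantumAdvantage.AdviceFreeQNC0.SeparableLDMA
import Summits.QuantumAdvantage.AdviceFreeQNC0.ProductBound
import HarnessLib

/-!
# Cell qa-qnc0 (rung F-Q1, route RingFrame, crux α, line `product`): the product game is hard for
# SEPARABLE column players (TARGET §17.2 Theorem S / Cor. (b), unconditional)

The product game of line `product` (`ProductHardPolylog`): Alice's columns and Bob's rows are win
patterns of stakes eliminators; LOSE = agreement.  `productHard_of_ldma_of_elimHard` (tree) derives
its hardness from the open stub `LDMAPolylog`.  Here the SEPARABLE case is settled outright: if
Alice's stakes in every column depend on the row `u` only through a partition label `π u` whose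
parts are supports of polynomials of degree `≤ (log₂ min(L, L'))^C` (any number of parts, any
class per column), then against EVERY Bob with rows of degree `≤ (log₂ min(L,L'))^C` at least
`μ·2^{L+L'}` cells are lost, `μ = κ·η₀` absolute (`productHard_separable`).  Proof = the tree's
`stub_product` argument (class-0 re-staking, zero-sum triple, row decomposition, potential costs,
`elimHard`) with step 3 (LDMA) supplied by `ldmaPolylog_separable` (PLDAMS at every density,
qn-lit's `pldams_allDensities`).

The cell's statement (planner TARGET §17.2, "PROVED in prose" modulo PLDAMS; now kernel and
unconditional); not in print.  WHAT THIS IS NOT: general (non-separable) Alice = `ProductHardPolylog`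
itself stays open (⟸ `LDMAPolylog`); nothing on α; no separation.
-/

noncomputable section

namespace Summit.QuantumAdvantage.AdviceFreeQNC0

open Finset
open Literature.Computability.MetaComplexity Literature.Computability.MetaComplexity.Smolensky

variable {L L' : ℕ}

/-- **Theorem S (b), unconditional: separable column players lose a constant fraction.**  There is
`μ > 0` such that for every `C`, all large `L, L'`, every partition label `π : {0,1}^L → Fin t` with
parts that are supports of degree-`≤ (log₂ min(L,L'))^C` polynomials, every `X` whose column `v` is
the win pattern of stakes `(a'_v(π u), b'_v(π u))` (any class `c_v`), and every `Y` whose rows are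
win patterns of degree `≤ (log₂ min(L,L'))^C`: `agreeCountR X Y ≥ μ·2^{L+L'}`.
(Cell statement, TARGET §17.2; via `ldmaPolylog_separable` + the `stub_product` chain.)
[cite: Srinivasan2023, Lemma 3.1] -/
theorem productHard_separable :
    ∃ μ : ℝ, 0 < μ ∧ ∀ C : ℕ, ∃ L₀ : ℕ, ∀ L L' : ℕ, L₀ ≤ L → L₀ ≤ L' →
      ∀ t : ℕ, ∀ π : (Fin L → Bool) → Fin t,
        (∀ s : Fin t, ∃ g : CubeFn (ZMod 2) L, g ∈ lowDeg (ZMod 2) L ((Nat.log 2 (min L L')) ^ C) ∧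
          ∀ u, g u ≠ 0 ↔ π u = s) →
      ∀ X Y : (Fin L → Bool) → (Fin L' → Bool) → Bool,
        (∀ v, ∃ c : ℕ, ∃ a' b' : Fin t → Bool,
          ∀ u, X u v = !(elimFail c (fun u => a' (π u)) (fun u => b' (π u)) u)) →
        (∀ u, IsElimWin ((Nat.log 2 (min L L')) ^ C) (fun v => Y u v)) →
          μ * (2 : ℝ) ^ (L + L') ≤ (agreeCountR X Y : ℝ) := by
  obtain ⟨κ, hκ, hLD⟩ := ldmaPolylog_separable
  obtain ⟨η₀, hη₀, hEl⟩ := elimHard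
  refine ⟨κ * η₀, mul_pos hκ hη₀, fun C => ?_⟩
  obtain ⟨L₁, hL₁⟩ := hLD C
  obtain ⟨n₀, hn₀⟩ := hEl C
  refine ⟨max L₁ n₀, fun L L' hL hL' t π hπ X Y hX hY => ?_⟩
  set D := (Nat.log 2 (min L L')) ^ C with hD
  -- Alice's class-0 stakes, column by column, as tables on the parts
  have hXc : ∀ v, ∃ AB : (Fin t → Bool) × (Fin t → Bool),
      ∀ u, X u v = !(elimFail 0 (fun u => AB.1 (π u)) (fun u => AB.2 (π u)) u) := by
    intro v
    obtain ⟨c, a', b', h⟩ := hX v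
    refine ⟨(fun s => (rot0 c (a' s) (b' s)).1, fun s => (rot0 c (a' s) (b' s)).2), fun u => ?_⟩
    rw [h u]
    unfold elimFail
    rw [elimFailBits_rot0 c (a' (π u)) (b' (π u)) (wt u)]
  choose AB hAB using hXc
  -- the zero-sum triple as maps `Γ r : u ↦ g_r(u, ·)`, factoring through `π`
  set G : Fin 3 → Fin t → (Fin L' → Bool) → Bool :=
    fun r s v => triple r ((AB v).1 s) ((AB v).2 s) with hG
  set Γ : Fin 3 → (Fin L → Bool) → (Fin L' → Bool) → Bool := fun r u => G r (π u) with hΓ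
  have hXΓ : ∀ u v, X u v = Γ (resLabel u) u v := fun u v => by
    rw [hAB v u]
    unfold elimFail
    rw [win_eq_triple]
  -- Bob's fail pattern in row `u`
  have hYf : ∀ u, IsElimFail D (fun v => !(Y u v)) := by
    intro u
    obtain ⟨c, a, b, ha, hb, h⟩ := hY u
    refine ⟨c, a, b, ha, hb, fun v => ?_⟩
    have hv : Y u v = !elimFail c a b v := h v
    show (!Y u v) = elimFail c a b v
    rw [hv, Bool.not_not]
  -- row decomposition
  have hrow : ∀ u, distFail D (Γ (resLabel u) u) ≤ (univ.filter fun v => X u v = Y u v).card := by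
    intro u
    refine le_trans (distFail_le _ (hYf u)) (le_of_eq ?_)
    unfold hdist
    congr 1
    ext v
    simp only [mem_filter, mem_univ, true_and, hXΓ u v]
    cases Γ (resLabel u) u v <;> cases Y u v <;> decide
  have hagree : agreeCountR X Y = ∑ u, (univ.filter fun v => X u v = Y u v).card := by
    unfold agreeCountR
    exact card_filter_prod_eq_sum (fun u v => X u v = Y u v)
  -- separable LDMA, one residue at a time
  have hLr : ∀ r : Fin 3, κ * ∑ u : Fin L → Bool, (distFail D (Γ r u) : ℝ) ≤
      ∑ u ∈ univ.filter (fun u => resLabel u = r), (distFail D (Γ r u) : ℝ) := by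
    intro r
    have h := hL₁ L L' (le_trans (le_max_left _ _) hL) (le_trans (le_max_left _ _) hL') D
      (Γ r) ⟨t, π, G r, hπ, fun u => rfl⟩ ((3 - r.val) % 3)
    have hset : (univ.filter fun u : Fin L → Bool => wt u % 3 = ((3 - r.val) % 3) % 3) =
        univ.filter fun u => resLabel u = r := by
      ext u
      simp only [mem_filter, mem_univ, true_and, resLabel, Fin.ext_iff]
      have := r.isLt
      omega
    rw [hset] at h
    push_cast at h
    exact h
  -- potential costs and the minimum fail weight
  have hpc : ∀ u : Fin L → Bool, (distFail D (fun _ : Fin L' → Bool => false) : ℝ) ≤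
      (distFail D (Γ 0 u) : ℝ) + distFail D (Γ 1 u) + distFail D (Γ 2 u) := fun u => by
    exact_mod_cast potential_cost D _ _ _ fun v => triple_sum ((AB v).1 (π u)) ((AB v).2 (π u))
  have hw : η₀ * (2 : ℝ) ^ L' ≤ (distFail D (fun _ : Fin L' → Bool => false) : ℝ) :=
    le_distFail_zero hn₀ (le_trans (le_max_right _ _) hL')
      (Nat.pow_le_pow_left (Nat.log_mono_right (min_le_right L L')) C)
  -- assembling the chain
  have h1 : (∑ u : Fin L → Bool, (distFail D (Γ (resLabel u) u) : ℝ)) ≤ (agreeCountR X Y : ℝ) := by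
    rw [hagree]
    push_cast
    exact Finset.sum_le_sum fun u _ => by exact_mod_cast hrow u
  have h2 : (∑ u : Fin L → Bool, (distFail D (Γ (resLabel u) u) : ℝ)) =
      ∑ r : Fin 3, ∑ u ∈ univ.filter (fun u => resLabel u = r), (distFail D (Γ r u) : ℝ) := by
    rw [← Finset.sum_fiberwise_of_maps_to (s := (univ : Finset (Fin L → Bool))) (t := (univ : Finset (Fin 3)))
      (g := resLabel) (fun u _ => mem_univ _) (f := fun u => (distFail D (Γ (resLabel u) u) : ℝ))]
    refine Finset.sum_congr rfl fun r _ => Finset.sum_congr rfl fun u hu => ?_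
    rw [(Finset.mem_filter.1 hu).2]
  have h4 : ∑ r : Fin 3, ∑ u : Fin L → Bool, (distFail D (Γ r u) : ℝ) =
      ∑ u : Fin L → Bool, ((distFail D (Γ 0 u) : ℝ) + distFail D (Γ 1 u) + distFail D (Γ 2 u)) := by
    rw [Finset.sum_comm]
    refine Finset.sum_congr rfl fun u _ => ?_
    rw [Fin.sum_univ_three]
  have hcard : (∑ _u : Fin L → Bool, (distFail D (fun _ : Fin L' → Bool => false) : ℝ)) =
      (2 : ℝ) ^ L * (distFail D (fun _ : Fin L' → Bool => false) : ℝ) := by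
    rw [Finset.sum_const, card_univ, Fintype.card_fun, Fintype.card_bool, Fintype.card_fin,
      nsmul_eq_mul]
    push_cast
    ring
  calc κ * η₀ * (2 : ℝ) ^ (L + L')
      = κ * ((2 : ℝ) ^ L * (η₀ * (2 : ℝ) ^ L')) := by rw [pow_add]; ring
    _ ≤ κ * ((2 : ℝ) ^ L * (distFail D (fun _ : Fin L' → Bool => false) : ℝ)) := by
        have h2L : (0 : ℝ) ≤ (2 : ℝ) ^ L := by positivity
        exact mul_le_mul_of_nonneg_left (mul_le_mul_of_nonneg_left hw h2L) hκ.le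
    _ = κ * ∑ _u : Fin L → Bool, (distFail D (fun _ : Fin L' → Bool => false) : ℝ) := by rw [hcard]
    _ ≤ κ * ∑ u : Fin L → Bool, ((distFail D (Γ 0 u) : ℝ) + distFail D (Γ 1 u) + distFail D (Γ 2 u)) :=
        mul_le_mul_of_nonneg_left (Finset.sum_le_sum fun u _ => hpc u) hκ.le
    _ = ∑ r : Fin 3, κ * ∑ u : Fin L → Bool, (distFail D (Γ r u) : ℝ) := by
        rw [← h4, Finset.mul_sum]
    _ ≤ ∑ r : Fin 3, ∑ u ∈ univ.filter (fun u => resLabel u = r), (distFail D (Γ r u) : ℝ) :=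
        Finset.sum_le_sum fun r _ => hLr r
    _ = ∑ u : Fin L → Bool, (distFail D (Γ (resLabel u) u) : ℝ) := h2.symm
    _ ≤ (agreeCountR X Y : ℝ) := h1

end Summit.QuantumAdvantage.AdviceFreeQNC0
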